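import Summits.BirchSwinnertonDyer.Rank1Residual.GaloisImage.KolyvaginSystemsCoreRankZero
import Summits.BirchSwinnertonDyer.Rank1Residual.GaloisImage.PropagatedStructureCartesian
import Summits.BirchSwinnertonDyer.Rank1Residual.GaloisImage.AbelianExtensionTorsion
import Summits.BirchSwinnertonDyer.Rank1Residual.X11b.TorsionLevelCohomology
import HarnessLib

/-!
# Scalar transport between two Kolyvagin levels, I: the maps `incl_*` and `red_*` on `H¹_{𝓕(d)}`
# (cell `b2b-bsdres`, team n1011, ROUTE-1 item R1-23 (a′) — skeleton `cells/n1011/skel/T-R1-23.md`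
# (n1011-p18) §2 S2–S3, file F-tr (seat p11); this is part 1 of 2, the cohomological tool lemmas)

HONEST FRAMING (verbatim for the cell): research route; prove what is provable now; no claim beyond
stated classes; nothing booked; no mark / label moved.  TOOL theorems only: no definition, no
named fact, every hypothesis a binder.

Two depths `k ≤ k'`: `E[3^{k+1}] = geomTorsion W (3^k · 3) ⊆ E[3^{k'+1}]` (`incl =
W.torsionInclusion`), and a reduction `red : E[3^{k'+1}] → E[3^{k+1}]` which is `x ↦ 3^{k'−k} x` on
geometric points (a BINDER pinned by `hred`, the R1-21₂ dictionary convention).  Contents: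

* `pow_succ_nsmul_geomTorsion`, `pow_succ_nsmul_galoisCohomology`: `E[3^{k+1}]` and
  `H¹(ℚ, E[3^{k+1}])` are killed by `3^{k+1}`; `geomTorsion_eq_zero_of_fixed_of_surj`:
  `E[3^{k+1}]^{Γ_ℚ} = 0` under `surj(3)` (T-R18c `geomPoints_eq_zero_of_fixed_of_pow_smul_eq_zero`);
* (L1) `map_torsionInclusion_injective`: `incl_*` is injective on `H¹(ℚ, ·)` when `E[3^{k'+1}]^{Γ_ℚ} = 0`
  (X11b `Levels.map_one_injective_of_forall_fixed_eq_zero`);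
* (L4) `map_torsionInclusion_map_red`: `incl_* ∘ red_* = 3^{k'−k}` on `H¹(ℚ, E[3^{k'+1}])`;
* `localMap_torsionInclusion_tateLocalMap`, `localMap_red_tateLocalMap`: at every place,
  `incl_* (π_{k+1})_* = (π_{k'+1})_* ∘ 3^{k'−k}` and `red_* (π_{k'+1})_* = (π_{k+1})_*` on `H¹(ℚ_v, T_3E)`
  (transition maps of the Tate module, `TateModule.pow_smul_proj_self_add`; p13's
  `PropagatedStructureCartesian` pattern);
* (L2) `map_torsionInclusion_mem_selmerGroup_atLevel`, (L3) `map_red_mem_selmerGroup_atLevel`: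
  `incl_*` maps `H¹_{𝓕_can^{(k)}(d)}` into `H¹_{𝓕_can^{(k')}(d)}` and `red_*` maps back, for the
  Mazur–Rubin propagated structures `propagatedSelmerStructure W 3 k` with CYCLOTOMIC transverse
  conditions at the places of `d` (kernels of restriction are functorial, `galoisCohomology.res_map_one`).

Part 2 (`KolyvaginScalarTransport.lean`) assembles `Transport.pow_dvd_iff_of_comp`.
-/

noncomputable section

open scoped Classical NumberField ContRepresentation
open Function Field NumberField IsDedekindDomain WeierstrassCurve
open Literature.NumberTheory.EllipticCurves
open Literature.NumberTheory.GaloisRepresentations Literature.NumberTheory.GaloisRepresentations.DiscreteGaloisModule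
  Literature.NumberTheory.GaloisCohomology

namespace Summit.BirchSwinnertonDyer.Rank1Residual.GaloisImage.Transport

section Torsion

variable (W : WeierstrassCurve ℚ)

/-- `E[3^k · 3]` is killed by `3^{k+1}`. [folklore] -/
theorem pow_succ_nsmul_geomTorsion (k : ℕ) (m : geomTorsion W (((3 : ℕ) : ℤ) ^ k * ((3 : ℕ) : ℤ))) :
    3 ^ (k + 1) • m = 0 := by
  apply Subtype.ext
  have hlev : (((3 : ℕ) : ℤ) ^ k * ((3 : ℕ) : ℤ)) = ((3 ^ (k + 1) : ℕ) : ℤ) := by push_cast; ring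
  rw [AddSubmonoidClass.coe_nsmul, ZeroMemClass.coe_zero, ← natCast_zsmul, ← hlev]
  exact (mem_geomTorsion_iff _ _ _).1 m.2

/-- `H¹(ℚ, E[3^k · 3])` is killed by `3^{k+1}`. [folklore] -/
theorem pow_succ_nsmul_galoisCohomology (k : ℕ)
    (c : galoisCohomology (W.torsionGaloisModule (((3 : ℕ) : ℤ) ^ k * ((3 : ℕ) : ℤ))) 1) :
    3 ^ (k + 1) • c = 0 :=
  galoisCohomology.nsmul_eq_zero_of_forall _ (pow_succ_nsmul_geomTorsion W k) c

/-- **`E(ℚ̄)[3^{k+1}]^{Γ_ℚ} = 0` under `surj(3)`** (`E(ℚ)[3^∞] = 0`; T-R18c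
`geomPoints_eq_zero_of_fixed_of_pow_smul_eq_zero` with `U = Γ_ℚ`). [cite: Serre1972, §5.2 (iv) and §5.4] -/
theorem geomTorsion_eq_zero_of_fixed_of_surj [W.IsElliptic]
    (hsurj : W.HasSurjectiveModNGaloisRep ((3 : ℕ) : ℤ)) (k : ℕ)
    (P : geomTorsion W (((3 : ℕ) : ℤ) ^ k * ((3 : ℕ) : ℤ)))
    (hP : ∀ σ : absoluteGaloisGroup ℚ, σ • P = P) : P = 0 := by
  haveI : Fact (Nat.Prime 3) := ⟨Nat.prime_three⟩
  have hirr := hasIrreducibleModPGaloisRep_of_hasSurjectiveModNGaloisRep W 3 hsurj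
  apply Subtype.ext
  refine geomPoints_eq_zero_of_fixed_of_pow_smul_eq_zero W 3 (by norm_num) hirr (U := ⊤) le_top
    (P : geomPoints W) (fun σ _ => congrArg Subtype.val (hP σ)) (k + 1) ?_
  have h := congrArg Subtype.val (pow_succ_nsmul_geomTorsion W k P)
  rwa [AddSubmonoidClass.coe_nsmul] at h

end Torsion

section Helpers

variable (W : WeierstrassCurve ℚ) [W.IsElliptic] {k k' : ℕ}

/-- `3^{k+1} ∣ 3^{k'+1}` in `ℤ` for `k ≤ k'` (the levels `E[3^{k+1}] ⊆ E[3^{k'+1}]`). [folklore] -/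
theorem pow_mul_dvd_pow_mul (hk : k ≤ k') :
    (((3 : ℕ) : ℤ) ^ k * ((3 : ℕ) : ℤ)) ∣ (((3 : ℕ) : ℤ) ^ k' * ((3 : ℕ) : ℤ)) :=
  mul_dvd_mul_right (pow_dvd_pow _ hk) _

omit [W.IsElliptic] in
/-- **(L1) `incl_* : H¹(ℚ, E[3^{k+1}]) → H¹(ℚ, E[3^{k'+1}])` is injective when `E(ℚ)[3] = 0`**
(no `Γ_ℚ`-fixed point of `E[3^{k'+1}]`; X11b `map_one_injective_of_forall_fixed_eq_zero`).
[cite: GreenbergLNM1716, §2 p. 63] -/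
theorem map_torsionInclusion_injective (hk : k ≤ k')
    (hΓ : ∀ P : geomTorsion W (((3 : ℕ) : ℤ) ^ k' * ((3 : ℕ) : ℤ)),
      (∀ σ : absoluteGaloisGroup ℚ, σ • P = P) → P = 0) :
    Function.Injective
      (galoisCohomology.map (W.torsionInclusion (pow_mul_dvd_pow_mul hk)) 1) := by
  -- the level as a natural number: `((3:ℤ)^k * 3) = ((3^(k+1) : ℕ) : ℤ)`
  have hlev : (((3 : ℕ) : ℤ) ^ k * ((3 : ℕ) : ℤ)) = ((3 ^ (k + 1) : ℕ) : ℤ) := by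
    push_cast; ring
  refine X11b.Levels.map_one_injective_of_forall_fixed_eq_zero (n := 3 ^ (k + 1)) ?_ ?_ ?_ ?_
  · -- every `3^{k+1}`-torsion point of `E[3^{k'+1}]` lies in `E[3^{k+1}]`
    intro b hb
    have hb' : (((3 : ℕ) : ℤ) ^ k * ((3 : ℕ) : ℤ)) • (b : geomPoints W) = 0 := by
      rw [hlev, natCast_zsmul, ← AddSubmonoidClass.coe_nsmul, hb, ZeroMemClass.coe_zero]
    exact ⟨⟨(b : geomPoints W), (mem_geomTorsion_iff _ _ _).2 hb'⟩, Subtype.ext rfl⟩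
  · intro a a' h
    exact Subtype.ext (congrArg (fun P : geomTorsion W (((3 : ℕ) : ℤ) ^ k' * ((3 : ℕ) : ℤ)) =>
      (P : geomPoints W)) h)
  · exact pow_succ_nsmul_geomTorsion W k
  · intro b hb
    exact hΓ b fun σ => by
      have h := hb σ
      rwa [torsionGaloisModule_apply_apply] at h

omit [W.IsElliptic] in
/-- **(L4) `incl_* ∘ red_* = 3^{k'−k}` on `H¹(ℚ, E[3^{k'+1}])`** when `red` is the reduction
`x ↦ 3^{k'−k} x` on points. [folklore] -/
theorem map_torsionInclusion_map_red (hk : k ≤ k')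
    (red : (W.torsionGaloisModule (((3 : ℕ) : ℤ) ^ k' * ((3 : ℕ) : ℤ))).toContRepresentation →ⁱL
      (W.torsionGaloisModule (((3 : ℕ) : ℤ) ^ k * ((3 : ℕ) : ℤ))).toContRepresentation)
    (hred : ∀ x : geomTorsion W (((3 : ℕ) : ℤ) ^ k' * ((3 : ℕ) : ℤ)),
      ((red x : geomTorsion W (((3 : ℕ) : ℤ) ^ k * ((3 : ℕ) : ℤ))) : geomPoints W) =
        (((3 : ℕ) : ℤ) ^ (k' - k)) • (x : geomPoints W))
    (y : galoisCohomology (W.torsionGaloisModule (((3 : ℕ) : ℤ) ^ k' * ((3 : ℕ) : ℤ))) 1) :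
    galoisCohomology.map (W.torsionInclusion (pow_mul_dvd_pow_mul hk)) 1
        (galoisCohomology.map red 1 y) = (3 ^ (k' - k)) • y := by
  obtain ⟨φ, rfl⟩ := oneCocycleClass_surjective _ y
  rw [galoisCohomology.map_one_oneCocycleClass, galoisCohomology.map_one_oneCocycleClass]
  have h := oneCocycleClass_smul (W.torsionGaloisModule (((3 : ℕ) : ℤ) ^ k' * ((3 : ℕ) : ℤ))).toTopRep
    (((3 ^ (k' - k) : ℕ) : ℤ)) φ
  conv at h => rhs; rw [Nat.cast_smul_eq_nsmul]
  refine Eq.trans ?_ h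
  refine congrArg (oneCocycleClass _) (Subtype.ext (ContinuousMap.ext fun σ => Subtype.ext ?_))
  change ((W.torsionInclusion (pow_mul_dvd_pow_mul hk) (red (φ.1 σ)) :
      geomTorsion W (((3 : ℕ) : ℤ) ^ k' * ((3 : ℕ) : ℤ))) : geomPoints W) =
    ((((3 ^ (k' - k) : ℕ) : ℤ) • φ.1 σ : geomTorsion W (((3 : ℕ) : ℤ) ^ k' * ((3 : ℕ) : ℤ))) :
      geomPoints W)
  rw [coe_torsionInclusion_apply, hred, AddSubgroupClass.coe_zsmul]
  push_cast
  rfl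

/-- **`incl_* ∘ (π_{k+1})_* = (π_{k'+1})_* ∘ 3^{k'−k}` locally**: on a crossed homomorphism
`η : Γ_{ℚ_v} → T_3E`, `incl (π_{k+1} η) = π_{k'+1} (3^{k'−k} η)` (the transition maps of the Tate
module, `TateModule.pow_smul_proj_self_add`). [folklore] -/
theorem localMap_torsionInclusion_tateLocalMap (hk : k ≤ k') (v : Place ℚ)
    (η : contOneCocycles (tateLocalRep W 3 v).toTopRep) :
    DiscreteGaloisModule.localMap (W.torsionInclusion (pow_mul_dvd_pow_mul hk)) v
        (tateLocalMap W 3 k v (oneCocycleClass (tateLocalRep W 3 v).toTopRep η)) =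
      tateLocalMap W 3 k' v
        (oneCocycleClass (tateLocalRep W 3 v).toTopRep ((((3 ^ (k' - k) : ℕ)) : ℤ) • η)) := by
  rw [tateLocalMap_oneCocycleClass, tateLocalMap_oneCocycleClass]
  erw [galoisCohomology.map_one_oneCocycleClass]
  congr 1
  apply Subtype.ext
  apply ContinuousMap.ext
  intro σ
  apply Subtype.ext
  show ((W.torsionInclusion (pow_mul_dvd_pow_mul hk) (tateToTorsion W 3 k (η.1 σ)) :
      geomTorsion W (((3 : ℕ) : ℤ) ^ k' * ((3 : ℕ) : ℤ))) : geomPoints W) =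
    ((tateToTorsion W 3 k' ((((3 ^ (k' - k) : ℕ)) : ℤ) • η.1 σ) :
      geomTorsion W (((3 : ℕ) : ℤ) ^ k' * ((3 : ℕ) : ℤ))) : geomPoints W)
  rw [coe_torsionInclusion_apply, coe_tateToTorsion_apply, coe_tateToTorsion_apply, map_zsmul,
    natCast_zsmul, show k' + 1 = (k' - k) + (k + 1) by omega]
  exact (TateModule.pow_smul_proj_self_add (k' - k) (k + 1) (η.1 σ)).symm

/-- **`red_* ∘ (π_{k'+1})_* = (π_{k+1})_*` locally** when `red` is `x ↦ 3^{k'−k} x` on points.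
[folklore] -/
theorem localMap_red_tateLocalMap (hk : k ≤ k')
    (red : (W.torsionGaloisModule (((3 : ℕ) : ℤ) ^ k' * ((3 : ℕ) : ℤ))).toContRepresentation →ⁱL
      (W.torsionGaloisModule (((3 : ℕ) : ℤ) ^ k * ((3 : ℕ) : ℤ))).toContRepresentation)
    (hred : ∀ x : geomTorsion W (((3 : ℕ) : ℤ) ^ k' * ((3 : ℕ) : ℤ)),
      ((red x : geomTorsion W (((3 : ℕ) : ℤ) ^ k * ((3 : ℕ) : ℤ))) : geomPoints W) =
        (((3 : ℕ) : ℤ) ^ (k' - k)) • (x : geomPoints W))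
    (v : Place ℚ) (η : contOneCocycles (tateLocalRep W 3 v).toTopRep) :
    DiscreteGaloisModule.localMap red v
        (tateLocalMap W 3 k' v (oneCocycleClass (tateLocalRep W 3 v).toTopRep η)) =
      tateLocalMap W 3 k v (oneCocycleClass (tateLocalRep W 3 v).toTopRep η) := by
  rw [tateLocalMap_oneCocycleClass, tateLocalMap_oneCocycleClass]
  erw [galoisCohomology.map_one_oneCocycleClass]
  congr 1
  apply Subtype.ext
  apply ContinuousMap.ext
  intro σ
  apply Subtype.ext
  show ((red (tateToTorsion W 3 k' (η.1 σ)) :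
      geomTorsion W (((3 : ℕ) : ℤ) ^ k * ((3 : ℕ) : ℤ))) : geomPoints W) =
    ((tateToTorsion W 3 k (η.1 σ) : geomTorsion W (((3 : ℕ) : ℤ) ^ k * ((3 : ℕ) : ℤ))) :
      geomPoints W)
  rw [hred, coe_tateToTorsion_apply, coe_tateToTorsion_apply, ← Nat.cast_pow, natCast_zsmul,
    show k' + 1 = (k' - k) + (k + 1) by omega]
  exact TateModule.pow_smul_proj_self_add (k' - k) (k + 1) (η.1 σ)

/-- **(L2) `incl_*` maps `H¹_{𝓕_can^{(k)}(d₀)}` into `H¹_{𝓕_can^{(k')}(d₀)}`** (propagated conditions: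
`incl ∘ π_k = π_{k'} ∘ 3^{k'−k}` on the Tate module; transverse conditions are functorial).
[cite: Rubin2011, §3.1 (p. 29)] -/
theorem map_torsionInclusion_mem_selmerGroup_atLevel (hk : k ≤ k')
    (D : KolyvaginDatum (W.torsionGaloisModule (((3 : ℕ) : ℤ) ^ k * ((3 : ℕ) : ℤ))))
    (D' : KolyvaginDatum (W.torsionGaloisModule (((3 : ℕ) : ℤ) ^ k' * ((3 : ℕ) : ℤ))))
    (hT : D.transverse = cyclotomicTransverse _) (hT' : D'.transverse = cyclotomicTransverse _)
    {d₀ : Finset (HeightOneSpectrum (𝓞 ℚ))}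
    {x : galoisCohomology (W.torsionGaloisModule (((3 : ℕ) : ℤ) ^ k * ((3 : ℕ) : ℤ))) 1}
    (hx : x ∈ (D.atLevel (propagatedSelmerStructure W 3 k) d₀).selmerGroup) :
    galoisCohomology.map (W.torsionInclusion (pow_mul_dvd_pow_mul hk)) 1 x ∈
      (D'.atLevel (propagatedSelmerStructure W 3 k') d₀).selmerGroup := by
  rw [SelmerStructure.mem_selmerGroup_iff] at hx ⊢
  intro v
  rw [CoreRankZero.localization_map_one_eq]
  -- the propagated places: `incl_* (π_k)_* [η] = (π_{k'})_* [3^{k'-k} η]`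
  have hprop : ∀ v : Place ℚ,
      galoisCohomology.localization _ v 1 x ∈ propagatedSelmerStructure W 3 k v →
        galoisCohomology.map ((W.torsionInclusion (pow_mul_dvd_pow_mul hk)).restrictField
            (Place.Completion v)) 1 (galoisCohomology.localization _ v 1 x) ∈
          propagatedSelmerStructure W 3 k' v := fun v hv => by
    obtain ⟨y, hy⟩ := (mem_propagatedSelmerStructure_iff W 3 k v _).mp hv
    obtain ⟨η, rfl⟩ := oneCocycleClass_surjective (tateLocalRep W 3 v).toTopRep y
    rw [← hy]
    exact (mem_propagatedSelmerStructure_iff W 3 k' v _).mpr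
      ⟨_, (localMap_torsionInclusion_tateLocalMap W hk v η).symm⟩
  rcases v with w | q
  · exact hprop (Sum.inl w) (hx (Sum.inl w))
  · by_cases hq : q ∈ d₀
    · have hxv := hx (Sum.inr q)
      rw [CoreRankZero.Level.atLevel_inr_of_mem _ _ hq, hT, cyclotomicTransverse_inr] at hxv
      rw [CoreRankZero.Level.atLevel_inr_of_mem _ _ hq, hT', cyclotomicTransverse_inr]
      have h0 : galoisCohomology.res (GaloisRep.restrictField (q.adicCompletion ℚ)
            (W.torsionGaloisModule (((3 : ℕ) : ℤ) ^ k * ((3 : ℕ) : ℤ))))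
          (CyclotomicField (Ideal.absNorm q.asIdeal) (q.adicCompletion ℚ)) 1
          (galoisCohomology.localization _ (Sum.inr q) 1 x) = 0 := hxv
      show galoisCohomology.res (GaloisRep.restrictField (q.adicCompletion ℚ)
            (W.torsionGaloisModule (((3 : ℕ) : ℤ) ^ k' * ((3 : ℕ) : ℤ))))
          (CyclotomicField (Ideal.absNorm q.asIdeal) (q.adicCompletion ℚ)) 1
          (galoisCohomology.map ((W.torsionInclusion (pow_mul_dvd_pow_mul hk)).restrictField
            (q.adicCompletion ℚ)) 1 (galoisCohomology.localization _ (Sum.inr q) 1 x)) = 0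
      rw [galoisCohomology.res_map_one, h0, map_zero]
    · have hxv := hx (Sum.inr q)
      rw [CoreRankZero.Level.atLevel_inr_of_not_mem _ _ hq] at hxv ⊢
      exact hprop (Sum.inr q) hxv

/-- **(L3) `red_*` maps `H¹_{𝓕_can^{(k')}(d₀)}` into `H¹_{𝓕_can^{(k)}(d₀)}`** (`red ∘ π_{k'} = π_k`;
transverse conditions functorial). [cite: Rubin2011, §3.1 (p. 29)] -/
theorem map_red_mem_selmerGroup_atLevel (hk : k ≤ k')
    (red : (W.torsionGaloisModule (((3 : ℕ) : ℤ) ^ k' * ((3 : ℕ) : ℤ))).toContRepresentation →ⁱL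
      (W.torsionGaloisModule (((3 : ℕ) : ℤ) ^ k * ((3 : ℕ) : ℤ))).toContRepresentation)
    (hred : ∀ x : geomTorsion W (((3 : ℕ) : ℤ) ^ k' * ((3 : ℕ) : ℤ)),
      ((red x : geomTorsion W (((3 : ℕ) : ℤ) ^ k * ((3 : ℕ) : ℤ))) : geomPoints W) =
        (((3 : ℕ) : ℤ) ^ (k' - k)) • (x : geomPoints W))
    (D : KolyvaginDatum (W.torsionGaloisModule (((3 : ℕ) : ℤ) ^ k * ((3 : ℕ) : ℤ))))
    (D' : KolyvaginDatum (W.torsionGaloisModule (((3 : ℕ) : ℤ) ^ k' * ((3 : ℕ) : ℤ))))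
    (hT : D.transverse = cyclotomicTransverse _) (hT' : D'.transverse = cyclotomicTransverse _)
    {d₀ : Finset (HeightOneSpectrum (𝓞 ℚ))}
    {y : galoisCohomology (W.torsionGaloisModule (((3 : ℕ) : ℤ) ^ k' * ((3 : ℕ) : ℤ))) 1}
    (hy : y ∈ (D'.atLevel (propagatedSelmerStructure W 3 k') d₀).selmerGroup) :
    galoisCohomology.map red 1 y ∈ (D.atLevel (propagatedSelmerStructure W 3 k) d₀).selmerGroup := by
  rw [SelmerStructure.mem_selmerGroup_iff] at hy ⊢
  intro v
  rw [CoreRankZero.localization_map_one_eq]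
  have hprop : ∀ v : Place ℚ,
      galoisCohomology.localization _ v 1 y ∈ propagatedSelmerStructure W 3 k' v →
        galoisCohomology.map (red.restrictField (Place.Completion v)) 1
            (galoisCohomology.localization _ v 1 y) ∈ propagatedSelmerStructure W 3 k v :=
    fun v hv => by
    obtain ⟨z, hz⟩ := (mem_propagatedSelmerStructure_iff W 3 k' v _).mp hv
    obtain ⟨η, rfl⟩ := oneCocycleClass_surjective (tateLocalRep W 3 v).toTopRep z
    rw [← hz]
    exact (mem_propagatedSelmerStructure_iff W 3 k v _).mpr
      ⟨_, (localMap_red_tateLocalMap W hk red hred v η).symm⟩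
  rcases v with w | q
  · exact hprop (Sum.inl w) (hy (Sum.inl w))
  · by_cases hq : q ∈ d₀
    · have hyv := hy (Sum.inr q)
      rw [CoreRankZero.Level.atLevel_inr_of_mem _ _ hq, hT', cyclotomicTransverse_inr] at hyv
      rw [CoreRankZero.Level.atLevel_inr_of_mem _ _ hq, hT, cyclotomicTransverse_inr]
      have h0 : galoisCohomology.res (GaloisRep.restrictField (q.adicCompletion ℚ)
            (W.torsionGaloisModule (((3 : ℕ) : ℤ) ^ k' * ((3 : ℕ) : ℤ))))
          (CyclotomicField (Ideal.absNorm q.asIdeal) (q.adicCompletion ℚ)) 1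
          (galoisCohomology.localization _ (Sum.inr q) 1 y) = 0 := hyv
      show galoisCohomology.res (GaloisRep.restrictField (q.adicCompletion ℚ)
            (W.torsionGaloisModule (((3 : ℕ) : ℤ) ^ k * ((3 : ℕ) : ℤ))))
          (CyclotomicField (Ideal.absNorm q.asIdeal) (q.adicCompletion ℚ)) 1
          (galoisCohomology.map (red.restrictField (q.adicCompletion ℚ)) 1
            (galoisCohomology.localization _ (Sum.inr q) 1 y)) = 0
      rw [galoisCohomology.res_map_one, h0, map_zero]
    · have hyv := hy (Sum.inr q)
      rw [CoreRankZero.Level.atLevel_inr_of_not_mem _ _ hq] at hyv ⊢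
      exact hprop (Sum.inr q) hyv

end Helpers

end Summit.BirchSwinnertonDyer.Rank1Residual.GaloisImage.Transport

end
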